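import Mathlib
import HarnessLib
import Literature.MathematicalPhysics.QuantumLattice.ScaleZeroMultiplierJoint
import Literature.MathematicalPhysics.QuantumLattice.ScaleZeroAngularFactorPeriodic
import Literature.MathematicalPhysics.QuantumLattice.ScaleZeroMultiplierBandPieces
import Summits.HubbardSuperconductivity.HubbardSuperconductivity.Theorems.KLProgrammeKLRegimeEngineScaleZeroAlphaWX5
import Summits.HubbardSuperconductivity.HubbardSuperconductivity.Theorems.KLProgrammeKLRegimeEngineScaleZeroValuesDefs
import Summits.HubbardSuperconductivity.HubbardSuperconductivity.Theorems.KLProgrammeKLRegimeEngineV8DefsG6Q6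
import Summits.HubbardSuperconductivity.HubbardSuperconductivity.Theorems.KLProgrammeKLRegimeEngineV8DefsU4

/-!
# K3 ENGINE package v6 — the THRESHOLD DOORS of the engine-flow registration (plan g16 (R29) «DOORS OK», finding E4-THR):
# `klEngC₃6 P R := min (klEngC₃3 P R) (klE4C₃ R)`, `klEngU₀6 P R c := min (klEngU₀4 P R c) (klE4U₀ R)`, and the CLOSED constants behind them

Cell `gate-hubbard-kl`, seat p4 (g9).  The smallness `θ_w ≤ 1/2` of the weighted scale-`0` step (k3c2-p1's `firstMoment_zero_le_of_torusSums`) and the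
`R`-independence of the (E4)₀ constant `E` read CLOSED BUT NON-NUMERIC constants of the tree (compactness existentials behind `Classical.choose`):
`uvTimeMomentConst klE0 7 32` (k3c4-p2), p3's `klCutoffX5` (order-`≤ 5` bound of `salmhoferCutoff`), and the two chosen here — **`klCutSqB5`** (order-`≤ 5`
bound of `bgmCutoffSqUnit klE0`, `exists_norm_iteratedDeriv_bgmCutoffSqUnit_le`) and **`klAngWA`** (order-`≤ 3` bound of the angular factors
`zoneAngularRaw 1 (1/4) 0 ω`, `exists_norm_iteratedFDeriv_zoneAngularRaw_le`).  So the two (E4)₀ smallness conditions are NOT consequences of the numeric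
thresholds `klEngC₃3`/`klEngU₀4`; they are absorbed by the `∃c₃`/`∃U₀` slots of `EngineP4` (chosen after `∀ R`), exactly as `CF`/`cE4` absorbed
`klIsoT`/`klE4T`.  This file defines

* §1 the chosen constants `klCutSqB5`, `klAngWA` with their defining bounds;
* §2 the closed `R`-terms (absolute values of `Gfr j` and `max 1 …` keep them positive for EVERY `R`; under `R.WF` they majorise the honest quantities):
  `klE4Abar R` (`Ā ≥ klScaleZeroA0 + A_T + 2·A_X(klCutoffX5; t ≤ 3)`, the weighted covariance constant, `A_w ≤ 4MĀ/β`), `klE4Mom R` (frame first-moment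
  slope), `klE4KapF R = max 0 (klKappaFrameC R) + 1`, `klE4X0` / `klE4XSlope R` (absolute part / slope of the multiplier space moment `T_X`, k3c2-p1's
  `spaceMoment_klAnisoFamily_zero_le`);
* §3 the doors **`klE4C₃ R := min (log 4/(128e⁵·Ā·(Mom+1))) (log 4/(2·XSlope))`**, **`klE4U₀ R := min (1/(128e⁹κ₀²·Ā·KapF)) (1/(8·XSlope))`**
  (`κ₀² = 2(7+6047)`), positive for every `R`, and the registration thresholds **`klEngC₃6`**, **`klEngU₀6`** with `_pos`, `_le_klEngC₃3` / `_le_klE4C₃`,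
  `_le_klEngU₀4` / `_le_klE4U₀` / `_le_klEngU₀3` (every closer keyed on `c ≤ klEngC₃3` / `U ≤ klEngU₀4` survives by one `le_trans`).

WHY THESE SIZES (proved in `…EngineScaleZeroE4Package`, not here): under `c ≤ klE4C₃ R`, `U ≤ klE4U₀ R` (and `U ≤ 1`, `β ≤ e^{c/U²}` so
`(n_β+1)U² ≤ c/log 4`): `64e⁹κ₀²Ā|U| ≤ 1/2`, `16e⁵Ā·(KapF·|U| + 2(c/log 4)·Mom) ≤ 3/8` (⇒ `θ_w ≤ 1/2`), and `XSlope·((n_β+1)U² + 2|U|) ≤ 3/4`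
(⇒ `T_X ≤ 8(klE4X0 + 1)·M/β`, `R`-free).  Definitions (closed real terms) and their signs only; nothing about the model is asserted; nothing asserts
superconductivity.  Risk-register item 1 disclosure: with these doors `U₀` is existential-absolute, not a numeral.
-/

noncomputable section

namespace Summit.HubbardSuperconductivity.HubbardSuperconductivity.Theorems.EngineV8

set_option linter.dupNamespace false -- summit = problem name (single-conjunct summit), D-0017

open Real Finset Literature.MathematicalPhysics.QuantumLattice Literature.Probability.LatticeModels
open Summit.HubbardSuperconductivity.HubbardSuperconductivity.Theorems.KLRegimeSplit

/-! ## §1 The two chosen analytic constants -/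

/-- `0 < klE0`. -/
theorem klE0_pos' : (0 : ℝ) < klE0 := by norm_num [klE0]

/-- **`klCutSqB5`** — a bound `≥ 1` of `‖(bgmCutoffSqUnit klE0)^{(i)}‖`, `i ≤ 5` (a choice constant; non-numeric). -/
def klCutSqB5 : ℝ := Classical.choose (exists_norm_iteratedDeriv_bgmCutoffSqUnit_le klE0_pos' 5)

/-- `1 ≤ klCutSqB5`. -/
theorem one_le_klCutSqB5 : 1 ≤ klCutSqB5 := (Classical.choose_spec (exists_norm_iteratedDeriv_bgmCutoffSqUnit_le klE0_pos' 5)).1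

/-- The defining bound of `klCutSqB5`. -/
theorem norm_iteratedDeriv_bgmCutoffSqUnit_le_klCutSqB5 : ∀ i ≤ 5, ∀ u : ℝ, ‖iteratedDeriv i (bgmCutoffSqUnit klE0) u‖ ≤ klCutSqB5 :=
  (Classical.choose_spec (exists_norm_iteratedDeriv_bgmCutoffSqUnit_le klE0_pos' 5)).2

/-- **`klAngWA`** — a global bound `≥ 0` of `‖Dʲ(zoneAngularRaw 1 (1/4) 0 ω)‖`, `j ≤ 3`, all `ω` (a choice constant; non-numeric). -/
def klAngWA : ℝ :=
  Classical.choose (exists_norm_iteratedFDeriv_zoneAngularRaw_le (r₁ := 1) (δ₀ := 1 / 4) (by norm_num) (by norm_num) 3 0)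

/-- `0 ≤ klAngWA`. -/
theorem klAngWA_nonneg : 0 ≤ klAngWA :=
  (Classical.choose_spec (exists_norm_iteratedFDeriv_zoneAngularRaw_le (r₁ := 1) (δ₀ := 1 / 4) (by norm_num) (by norm_num) 3 0)).1

/-- The defining bound of `klAngWA`. -/
theorem norm_iteratedFDeriv_zoneAngularRaw_le_klAngWA :
    ∀ j ≤ 3, ∀ (ω : ℤ) (P : EuclideanSpace ℝ (Fin 2)), ‖iteratedFDeriv ℝ j (zoneAngularRaw 1 (1 / 4) 0 ω) P‖ ≤ klAngWA :=
  (Classical.choose_spec (exists_norm_iteratedFDeriv_zoneAngularRaw_le (r₁ := 1) (δ₀ := 1 / 4) (by norm_num) (by norm_num) 3 0)).2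

/-! ## §2 The closed `R`-terms of the doors -/

/-- **`klE4Abar R`** — majorant of the weighted covariance constant `Ā = klScaleZeroA0 + A_T + 2·A_X` at `B := klCutoffX5`, with the regime factor
`(N_sc+1)U² + 2|U|` replaced by `3` and `Gfr j` by `|Gfr j|`; wrapped in `max 1` (positive for every `R`). -/
def klE4Abar (R : RenConsts) : ℝ :=
  max 1 (klScaleZeroA0 + uvTimeMomentConst klE0 7 32 +
    2 * (uvSpaceMomentConst klE0 1 (uvPieceSq klE0 (uvBaseQ klCutoffX5 klE0 4) (uvBaseQ' klCutoffX5 klE0 4)) +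
      (1 / 4 * Real.sqrt (216 * (1 / klE0 + 1 / 2)) *
          ∑ e : Fin 2 × Fin 2, (uvLinV klE0 (1 + (e.1 : ℕ) + (e.2 : ℕ)) *
              (klCutoffX5 * ((1 + ((e.1 : ℕ) + (e.2 : ℕ)) + 2).factorial : ℝ) * (4 / klE0) ^ (1 + ((e.1 : ℕ) + (e.2 : ℕ)) + 1)) +
            uvLinD klE0 (1 + (e.1 : ℕ) + (e.2 : ℕ)) *
              (klCutoffX5 * ((1 + ((e.1 : ℕ) + (e.2 : ℕ)) + 3).factorial : ℝ) * (4 / klE0) ^ (1 + ((e.1 : ℕ) + (e.2 : ℕ)) + 2)))) *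
        (4608 * (1 + |R.Gfr 0| + |R.Gfr 1| + |R.Gfr 2| + |R.Gfr 3|) ^ 4 * 3)))

/-- `1 ≤ klE4Abar R` (hence `0 < klE4Abar R`) for every `R`. -/
theorem one_le_klE4Abar (R : RenConsts) : 1 ≤ klE4Abar R := le_max_left _ _

/-- `0 < klE4Abar R`. -/
theorem klE4Abar_pos (R : RenConsts) : 0 < klE4Abar R := lt_of_lt_of_le one_pos (one_le_klE4Abar R)

/-- **`klE4Mom R`** — the first-moment slope of an admissible frame's position kernel (`Σ_z|z̃_j|‖Ǩ z‖ ≤ (N_sc+1)U²·klE4Mom R` under `R.WF`). -/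
def klE4Mom (R : RenConsts) : ℝ :=
  6 * (Real.pi * |R.Gfr 1| / 2 + Real.pi ^ 2 * |R.Gfr 2| / (2 * Real.sqrt 2) + Real.pi ^ 3 * |R.Gfr 3| / 8)

/-- `0 ≤ klE4Mom R`. -/
theorem klE4Mom_nonneg (R : RenConsts) : 0 ≤ klE4Mom R := by unfold klE4Mom; positivity

/-- **`klE4KapF R := max 0 (klKappaFrameC R) + 1`** — the frame's `ℓ¹` slope plus one (positive for every `R`). -/
def klE4KapF (R : RenConsts) : ℝ := max 0 (klKappaFrameC R) + 1

/-- `1 ≤ klE4KapF R`. -/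
theorem one_le_klE4KapF (R : RenConsts) : 1 ≤ klE4KapF R := by
  unfold klE4KapF; have := le_max_left 0 (klKappaFrameC R); linarith

/-- **`klE4X0`** — the absolute part `C₀'(klCutSqB5, klAngWA)` of the multiplier space moment `T_X`. -/
def klE4X0 : ℝ :=
  uvSpaceMomentConst (2 * klE0) 1 (uvPieceSq (2 * klE0) (multAmp klCutSqB5 klE0 4 (fun _ => klAngWA) 0) (multAmp klCutSqB5 klE0 4 (fun _ => klAngWA) 1))

/-- **`klE4XSlope R`** — majorant (`max 1`) of the slope `C₁'(klCutSqB5)·klAngWA·36864·(1+Σ|Gfr|)⁴` of `T_X`. -/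
def klE4XSlope (R : RenConsts) : ℝ :=
  max 1 ((1 / 4 * Real.sqrt (216 * (1 / (2 * klE0) + 1 / 2)) *
      ∑ e : Fin 2 × Fin 2, (uvLinV (2 * klE0) (1 + (e.1 : ℕ) + (e.2 : ℕ)) *
          (klE0 / 2 * (((1 + ((e.1 : ℕ) + (e.2 : ℕ)) + 1).factorial : ℝ) * klCutSqB5 * (2 / klE0) ^ (1 + ((e.1 : ℕ) + (e.2 : ℕ)) + 1))) +
        uvLinD (2 * klE0) (1 + (e.1 : ℕ) + (e.2 : ℕ)) *
          (klE0 / 2 * (((1 + ((e.1 : ℕ) + (e.2 : ℕ)) + 2).factorial : ℝ) * klCutSqB5 * (2 / klE0) ^ (1 + ((e.1 : ℕ) + (e.2 : ℕ)) + 2))))) *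
    (klAngWA * (36864 * (1 + |R.Gfr 0| + |R.Gfr 1| + |R.Gfr 2| + |R.Gfr 3|) ^ 4)))

/-- `1 ≤ klE4XSlope R`. -/
theorem one_le_klE4XSlope (R : RenConsts) : 1 ≤ klE4XSlope R := le_max_left _ _

/-- `0 < klE4XSlope R`. -/
theorem klE4XSlope_pos (R : RenConsts) : 0 < klE4XSlope R := lt_of_lt_of_le one_pos (one_le_klE4XSlope R)

/-! ## §3 The doors and the registration thresholds -/

/-- **`klE4C₃ R`** — the (E4)₀ regime-constant door: `min (log 4/(128e⁵·Ā·(Mom+1))) (log 4/(2·XSlope))`. -/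
def klE4C₃ (R : RenConsts) : ℝ :=
  min (Real.log 4 / (128 * Real.exp 1 ^ 5 * klE4Abar R * (klE4Mom R + 1))) (Real.log 4 / (2 * klE4XSlope R))

/-- `0 < klE4C₃ R` for every `R`. -/
theorem klE4C₃_pos (R : RenConsts) : 0 < klE4C₃ R := by
  have h4 : 0 < Real.log 4 := Real.log_pos (by norm_num)
  have hA := klE4Abar_pos R
  have hM := klE4Mom_nonneg R
  have hX := klE4XSlope_pos R
  unfold klE4C₃
  exact lt_min (by positivity) (by positivity)

/-- **`klE4U₀ R`** — the (E4)₀ coupling door: `min (1/(128e⁹κ₀²·Ā·KapF)) (1/(8·XSlope))`, `κ₀² = 2(7+6047)`. -/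
def klE4U₀ (R : RenConsts) : ℝ :=
  min (1 / (128 * Real.exp 1 ^ 9 * (2 * (7 + 6047)) * klE4Abar R * klE4KapF R)) (1 / (8 * klE4XSlope R))

/-- `0 < klE4U₀ R` for every `R`. -/
theorem klE4U₀_pos (R : RenConsts) : 0 < klE4U₀ R := by
  have hA := klE4Abar_pos R
  have hK : 0 < klE4KapF R := lt_of_lt_of_le one_pos (one_le_klE4KapF R)
  have hX := klE4XSlope_pos R
  unfold klE4U₀
  exact lt_min (by positivity) (by positivity)

/-- **`klEngC₃6 P R := min (klEngC₃3 P R) (klE4C₃ R)`** — the regime-constant threshold of the engine-flow registration. -/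
def klEngC₃6 (P : SplitConsts) (R : RenConsts) : ℝ := min (klEngC₃3 P R) (klE4C₃ R)

/-- `0 < klEngC₃6 P R`. -/
theorem klEngC₃6_pos (P : SplitConsts) (R : RenConsts) : 0 < klEngC₃6 P R := lt_min (klEngC₃3_pos P R) (klE4C₃_pos R)

/-- `klEngC₃6 P R ≤ klEngC₃3 P R`. -/
theorem klEngC₃6_le_klEngC₃3 (P : SplitConsts) (R : RenConsts) : klEngC₃6 P R ≤ klEngC₃3 P R := min_le_left _ _

/-- `klEngC₃6 P R ≤ klE4C₃ R`. -/
theorem klEngC₃6_le_klE4C₃ (P : SplitConsts) (R : RenConsts) : klEngC₃6 P R ≤ klE4C₃ R := min_le_right _ _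

/-- **`klEngU₀6 P R c := min (klEngU₀4 P R c) (klE4U₀ R)`** — the coupling threshold of the engine-flow registration. -/
def klEngU₀6 (P : SplitConsts) (R : RenConsts) (c : ℝ) : ℝ := min (klEngU₀4 P R c) (klE4U₀ R)

/-- `0 < klEngU₀6 P R c`. -/
theorem klEngU₀6_pos (P : SplitConsts) (R : RenConsts) (c : ℝ) : 0 < klEngU₀6 P R c := lt_min (klEngU₀4_pos P R c) (klE4U₀_pos R)

/-- `klEngU₀6 P R c ≤ klEngU₀4 P R c`. -/
theorem klEngU₀6_le_klEngU₀4 (P : SplitConsts) (R : RenConsts) (c : ℝ) : klEngU₀6 P R c ≤ klEngU₀4 P R c := min_le_left _ _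

/-- `klEngU₀6 P R c ≤ klE4U₀ R`. -/
theorem klEngU₀6_le_klE4U₀ (P : SplitConsts) (R : RenConsts) (c : ℝ) : klEngU₀6 P R c ≤ klE4U₀ R := min_le_right _ _

/-- `klEngU₀6 P R c ≤ klEngU₀3 P R c` (through `klEngU₀4_le_klEngU₀3`). -/
theorem klEngU₀6_le_klEngU₀3 (P : SplitConsts) (R : RenConsts) (c : ℝ) : klEngU₀6 P R c ≤ klEngU₀3 P R c :=
  (klEngU₀6_le_klEngU₀4 P R c).trans (klEngU₀4_le_klEngU₀3 P R c)

end Summit.HubbardSuperconductivity.HubbardSuperconductivity.Theorems.EngineV8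

end
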